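import Mathlib
import HarnessLib
import Summits.ValiantsHypothesis.ValiantsHypothesis.Theorems.MonotoneRestorationOrbitRestorationQPCorePatterns

/-!
# Core patterns, affine form: all-placements power sums of a local AFFINE form (with the invariant part `β₀ + δ·U`)

Route MonotoneRestoration, crux `OrbitRestorationQP` (stmt-ValiantsHypothesis-18293), SPAN-currency lane of the open
sub-rung A_∞ (`stub_sigmaPiSigmaValue`); evidence note `SPAN-CURRENCY-A1-g7g4.md` §2 Step 5, completing the ENGINE of
`…CorePatterns.lean` for AFFINE local forms: by `LocalFactors.exists_rowColSupports_of_matrixSymmetric` every factor of a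
matrix-symmetric affine product is `β₀ + δ U + (Σ_{ab} α_{ab} x_{ab} + Σ_a β_a R_a + Σ_b γ_b C_b)` placed along its row /
column supports, `U = Σ_{ij} x_{ij}` the (invariant) total sum.  Helper (`--supports`), def-free.

* `homPoly_singleEdge`, `totalSum_mem_narrowSpan` — `U` is the homomorphism polynomial of the single-edge pattern
  (treewidth `≤ 1`), so `(C β₀ + C δ · U)^m` lies in the narrow span (`invariantPart_pow_mem_narrowSpan`, through
  `NarrowSpanAlgebra.mem_narrowSpan_of_mem_adjoin`);
* **`sum_placements_pow_affineLocalForm_mem_narrowSpan`** — for every datum `(β₀, δ, α, β, γ)` on the core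
  `Fin r × Fin c` and every `k`, `Σ_{φ,ψ} (β₀ + δ U + ℓ^{φ,ψ})^k ∈ span_ℂ {hom_{F,n} : tw F ≤ r + c + 1}` (binomial
  theorem, the linear engine `CorePatterns.sum_placements_pow_localForm_mem_narrowSpan`, and
  `NarrowSpanAlgebra.narrowSpan_mul_mem`).

Honest label: infrastructure; no stub closed; VP ≠ VNP untouched.
-/

noncomputable section

-- `Summit.ValiantsHypothesis.ValiantsHypothesis.…` is the tree's single-conjunct layout (Sub = Summit).
set_option linter.dupNamespace false

namespace Summit.ValiantsHypothesis.ValiantsHypothesis.Theorems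

namespace CorePatterns

open MvPolynomial Finset
open Literature.Computability.AlgebraicComplexity (homPoly)
open Literature.Combinatorics.SimpleGraph (treewidth treewidth_le_card_sub_one)

/-- **The total sum `U = Σ_{ij} x_{ij}` is the homomorphism polynomial of the single-edge pattern.**
[cite: DwivediPagoSeppelt2026, eq. (1)] -/
theorem homPoly_singleEdge (n : ℕ) :
    homPoly ({((0 : Fin 1), (0 : Fin 1))} : Multiset (Fin 1 × Fin 1)) n ℂ =
      ∑ i : Fin n, ∑ j : Fin n, (X (i, j) : MvPolynomial (Fin n × Fin n) ℂ) := by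
  unfold homPoly
  simp only [Multiset.map_singleton, Multiset.prod_singleton]
  rw [Fintype.sum_prod_type]
  refine (Fintype.sum_equiv (Equiv.funUnique (Fin 1) (Fin n)) _
    (fun i : Fin n => ∑ h₂ : Fin 1 → Fin n, (X (i, h₂ 0) : MvPolynomial (Fin n × Fin n) ℂ))
    (fun h₁ => rfl)).trans ?_
  refine Finset.sum_congr rfl fun i _ => ?_
  exact Fintype.sum_equiv (Equiv.funUnique (Fin 1) (Fin n)) _ _ fun h₂ => rfl

/-- The single-edge pattern graph has treewidth `≤ 1`. [folklore] -/
theorem treewidth_singleEdge_le :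
    treewidth (SimpleGraph.fromRel fun u v : Fin 1 ⊕ Fin 1 =>
      ∃ e ∈ ({((0 : Fin 1), (0 : Fin 1))} : Multiset (Fin 1 × Fin 1)), u = Sum.inl e.1 ∧ v = Sum.inr e.2) ≤ 1 := by
  refine (treewidth_le_card_sub_one _).trans ?_
  simp

/-- `U` lies in the narrow span for every treewidth bound `w ≥ 1`. [folklore] -/
theorem totalSum_mem_narrowSpan (n w : ℕ) (hw : 1 ≤ w) :
    (∑ i : Fin n, ∑ j : Fin n, (X (i, j) : MvPolynomial (Fin n × Fin n) ℂ)) ∈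
      Submodule.span ℂ {p : MvPolynomial (Fin n × Fin n) ℂ |
        ∃ (a b : ℕ) (E : Multiset (Fin a × Fin b)),
          treewidth (SimpleGraph.fromRel fun u v : Fin a ⊕ Fin b =>
            ∃ e ∈ E, u = Sum.inl e.1 ∧ v = Sum.inr e.2) ≤ w ∧ p = homPoly E n ℂ} :=
  Submodule.subset_span ⟨1, 1, _, treewidth_singleEdge_le.trans hw, (homPoly_singleEdge n).symm⟩

/-- **Powers of the invariant part `C β₀ + C δ · U` lie in the narrow span** (`w ≥ 1`). [folklore] -/
theorem invariantPart_pow_mem_narrowSpan (n w : ℕ) (hw : 1 ≤ w) (β₀ δ : ℂ) (m : ℕ) :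
    (C β₀ + C δ * ∑ i : Fin n, ∑ j : Fin n, (X (i, j) : MvPolynomial (Fin n × Fin n) ℂ)) ^ m ∈
      Submodule.span ℂ {p : MvPolynomial (Fin n × Fin n) ℂ |
        ∃ (a b : ℕ) (E : Multiset (Fin a × Fin b)),
          treewidth (SimpleGraph.fromRel fun u v : Fin a ⊕ Fin b =>
            ∃ e ∈ E, u = Sum.inl e.1 ∧ v = Sum.inr e.2) ≤ w ∧ p = homPoly E n ℂ} := by
  refine NarrowSpanAlgebra.mem_narrowSpan_of_mem_adjoin n w (Subalgebra.pow_mem _ ?_ m)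
  refine Subalgebra.add_mem _ ?_ (Subalgebra.mul_mem _ ?_ ?_)
  · rw [← MvPolynomial.algebraMap_eq]; exact Subalgebra.algebraMap_mem _ _
  · rw [← MvPolynomial.algebraMap_eq]; exact Subalgebra.algebraMap_mem _ _
  · exact Algebra.subset_adjoin ⟨1, 1, _, treewidth_singleEdge_le.trans hw, (homPoly_singleEdge n).symm⟩

/-- **THE AFFINE ENGINE.**  For every datum `(β₀, δ, α, β, γ)` on the core `Fin r × Fin c` and every `k`, the
all-placements power sum `Σ_{φ,ψ} (β₀ + δ U + Σ_{ab} α_{ab} x_{φ a, ψ b} + Σ_a β_a R_{φ a} + Σ_b γ_b C_{ψ b})^k` lies in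
`span_ℂ {hom_{F,n} : tw F ≤ r + c + 1}`. [folklore; cite: DwivediPagoSeppelt2026, §8] -/
theorem sum_placements_pow_affineLocalForm_mem_narrowSpan (n r c k : ℕ) (β₀ δ : ℂ) (α : Fin r × Fin c → ℂ)
    (β : Fin r → ℂ) (γ : Fin c → ℂ) :
    (∑ φ : Fin r → Fin n, ∑ ψ : Fin c → Fin n,
      ((C β₀ + C δ * ∑ i : Fin n, ∑ j : Fin n, (X (i, j) : MvPolynomial (Fin n × Fin n) ℂ)) +
        ((∑ ab : Fin r × Fin c, C (α ab) * (X (φ ab.1, ψ ab.2) : MvPolynomial (Fin n × Fin n) ℂ)) +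
          (∑ a : Fin r, C (β a) * ∑ j : Fin n, (X (φ a, j) : MvPolynomial (Fin n × Fin n) ℂ)) +
          (∑ b : Fin c, C (γ b) * ∑ j : Fin n, (X (j, ψ b) : MvPolynomial (Fin n × Fin n) ℂ)))) ^ k) ∈
    Submodule.span ℂ {p : MvPolynomial (Fin n × Fin n) ℂ |
        ∃ (a b : ℕ) (E : Multiset (Fin a × Fin b)),
          treewidth (SimpleGraph.fromRel fun u v : Fin a ⊕ Fin b =>
            ∃ e ∈ E, u = Sum.inl e.1 ∧ v = Sum.inr e.2) ≤ r + c + 1 ∧ p = homPoly E n ℂ} := by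
  -- binomial expansion of the OUTER sum only, then swap the sums
  have hexp : ∀ (φ : Fin r → Fin n) (ψ : Fin c → Fin n),
      ((C β₀ + C δ * ∑ i : Fin n, ∑ j : Fin n, (X (i, j) : MvPolynomial (Fin n × Fin n) ℂ)) +
        ((∑ ab : Fin r × Fin c, C (α ab) * (X (φ ab.1, ψ ab.2) : MvPolynomial (Fin n × Fin n) ℂ)) +
          (∑ a : Fin r, C (β a) * ∑ j : Fin n, (X (φ a, j) : MvPolynomial (Fin n × Fin n) ℂ)) +
          (∑ b : Fin c, C (γ b) * ∑ j : Fin n, (X (j, ψ b) : MvPolynomial (Fin n × Fin n) ℂ)))) ^ k =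
      ∑ m ∈ Finset.range (k + 1),
        (C β₀ + C δ * ∑ i : Fin n, ∑ j : Fin n, (X (i, j) : MvPolynomial (Fin n × Fin n) ℂ)) ^ m *
          ((∑ ab : Fin r × Fin c, C (α ab) * (X (φ ab.1, ψ ab.2) : MvPolynomial (Fin n × Fin n) ℂ)) +
            (∑ a : Fin r, C (β a) * ∑ j : Fin n, (X (φ a, j) : MvPolynomial (Fin n × Fin n) ℂ)) +
            (∑ b : Fin c, C (γ b) * ∑ j : Fin n, (X (j, ψ b) : MvPolynomial (Fin n × Fin n) ℂ))) ^ (k - m) *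
          ((k.choose m : ℕ) : MvPolynomial (Fin n × Fin n) ℂ) :=
    fun φ ψ => add_pow _ _ k
  simp_rw [hexp]
  simp_rw [Finset.sum_comm (γ := Fin c → Fin n) (t := Finset.range (k + 1))]
  rw [Finset.sum_comm]
  refine Submodule.sum_mem _ fun m _ => ?_
  simp_rw [← Finset.sum_mul, ← Finset.mul_sum]
  have hmono : Submodule.span ℂ {p : MvPolynomial (Fin n × Fin n) ℂ |
        ∃ (a b : ℕ) (E : Multiset (Fin a × Fin b)),
          treewidth (SimpleGraph.fromRel fun u v : Fin a ⊕ Fin b =>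
            ∃ e ∈ E, u = Sum.inl e.1 ∧ v = Sum.inr e.2) ≤ r + c ∧ p = homPoly E n ℂ} ≤
      Submodule.span ℂ {p : MvPolynomial (Fin n × Fin n) ℂ |
        ∃ (a b : ℕ) (E : Multiset (Fin a × Fin b)),
          treewidth (SimpleGraph.fromRel fun u v : Fin a ⊕ Fin b =>
            ∃ e ∈ E, u = Sum.inl e.1 ∧ v = Sum.inr e.2) ≤ r + c + 1 ∧ p = homPoly E n ℂ} := by
    refine Submodule.span_mono ?_
    rintro p ⟨a, b, E, hE, rfl⟩
    exact ⟨a, b, E, hE.trans (Nat.le_succ _), rfl⟩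
  have hv := hmono (sum_placements_pow_localForm_mem_narrowSpan n r c (k - m) α β γ)
  have hu := invariantPart_pow_mem_narrowSpan n (r + c + 1) (by omega) β₀ δ m
  have huv := NarrowSpanAlgebra.narrowSpan_mul_mem n (r + c + 1) hu hv
  rw [mul_comm, ← nsmul_eq_mul]
  exact nsmul_mem huv _

end CorePatterns

end Summit.ValiantsHypothesis.ValiantsHypothesis.Theorems

end
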